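import Mathlib.Analysis.Meromorphic.Order
import Literature.NumberTheory.Automorphic.AutomorphicLFunctions
import Literature.NumberTheory.Automorphic.AutomorphicLFunctionFlathProofs
import HarnessLib

/-!
# Meromorphic continuation of the standard L-function of `GL_n` (lang.S21): reductions, inputs
(companion to `Literature.NumberTheory.Automorphic.AutomorphicLFunctions`; first layer of the
decomposition of `Literature.NumberTheory.Automorphic.godementJacquet_hasMeromorphicContinuation`)

Module history: this content was accepted as proposal p11310 (2026-08-14) at the path
`Literature/NumberTheory/Automorphic/AutomorphicLFunctionsProofs.lean`, a path subsequently taken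
over by the companion file of the sibling fact
`Literature.NumberTheory.Automorphic.partialStandardL_hasMeromorphicContinuation` (which assembles that fact *from*
`godementJacquet_hasMeromorphicContinuation`, Flath and Jacquet–Shalika — the converse direction of
the assembly below); it is re-homed here unchanged in content, under a Godement–Jacquet-specific
name, and is imported by
`Literature.NumberTheory.Automorphic.GodementJacquetZetaIntegrals` (the next layer: global zeta
integrals). All declaration names are disjoint from those of `AutomorphicLFunctionsProofs`, so the
two modules can be imported together.

The named fact `Literature.NumberTheory.Automorphic.godementJacquet_hasMeromorphicContinuation` of `AutomorphicLFunctions`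
(for every cuspidal automorphic representation `Π` of `GL_n(𝔸_K)` some standard L-function
datum `D` has `D.L` meromorphic on `ℂ`, `LFunction.HasMeromorphicContinuation`: a meromorphic
function on `ℂ` agreeing with the Euler product `D.L` on `re s > 1`) is, over the tree's honest
definitions (`CuspidalAutomorphicRepGL` = irreducible closed subrepresentations of `L²_cusp`,
Satake parameters = spherical Hecke eigenvalues), the conjunction of two theorems in print:

* Godement–Jacquet, *Zeta functions of simple algebras*, LNM 260 (1972), Thm. 13.8: the Euler
  product `L(s, π) = ∏_v L(s, π_v)` of an automorphic cuspidal `π` converges absolutely in *some*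
  right half-plane and extends to a meromorphic function on `ℂ` (entire unless `n = 1` and `π`
  is a power of the idelic norm; restated in Rudnick–Sarnak, Duke Math. J. 81 (1996), §2,
  p. 276, (2.8)–(2.9), and Getz–Hahn (2024), Thm. 11.7.1 with `m = 1`, `π'` trivial); with
  Thm. 3.3 loc. cit. (the non-archimedean local factors are inverses of polynomials in `q_v^{-s}`
  with constant term `1`) the same holds for every partial L-function `L^S(s, π)`;
* Jacquet–Shalika, Amer. J. Math. 103 (1981), Thm. (5.3): the Euler product converges
  (absolutely) on the whole half-plane `re s > 1`, so that the continuation agrees with the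
  product there (and not only far to the right).

Neither the global theory of LNM 260 (zeta integrals of Schwartz–Bruhat functions on `M_n(𝔸_K)`
against matrix coefficients, adelic Poisson summation, §§10–13) nor its local theory (Thm. 3.3
non-archimedean, §8 archimedean) is in Mathlib or in the tree, so this file records the
*architecture* of the printed proof, proves its complex-analytic glue once and for all, and
threads it to the named fact:

* `StandardLFunctionData.ofSatakeFamily` (**definition**) and `ofSatakeFamily_L` (**proved**): the
  datum of `Π` with exceptional set `S`, an honest Satake family `α` off `S` and the local factor
  `1` at `v ∈ S`; its L-function *is* the partial standard L-function `L^S(s, α)` (all `s`, no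
  convergence needed: a `tprod` over a type and over the subtype carrying its support agree).
* `Lang.godementJacquet_hasMeromorphicContinuation_of_partialStandardL` (**proved**, the
  assembly): the fact follows from its sibling `Lang.partialStandardL_hasMeromorphicContinuation`
  (lang.S21, partial L-functions) and the finiteness of ramification (Flath (1979), Thm. 3 —
  *proved* in the tree, `CuspidalAutomorphicRepGL.exists_finset_isSatakeFamilyOf` of
  `AutomorphicLFunctionFlathProofs`).
* `Lang.exists_hasMeromorphicContinuation_of_godementJacquet` (**proved**): for `Π` other than the
  trivial representation of `GL_1` the fact is also a projection of the entire form
  `Lang.godementJacquet` (entire ⇒ meromorphic).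
* `LFunction.exists_meromorphic_eqOn_halfPlane` and its case `c = 1`,
  `LFunction.hasMeromorphicContinuation_of_halfPlane` (**proved**, complex analysis): if `g₀` is
  meromorphic on `ℂ` and agrees with `L` on *some* right half-plane `re s > x₀`, and `L` is
  holomorphic on `re s > c`, then some meromorphic function on `ℂ` agrees with `L` on all of
  `re s > c` (for `c = 1`: `LFunction.HasMeromorphicContinuation L`): by the identity principle
  for meromorphic functions (Mathlib `MeromorphicOn.meromorphicOrderAt_ne_top_of_isPreconnected`)
  `g₀ - L` vanishes identically near every point of the connected half-plane `re s > c`, hence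
  `g₀ = L` at every point of `re s > c` where `g₀` is analytic, and the function patched from `L`
  (on `re s > c`) and `g₀` (elsewhere) is meromorphic.
* `LFunction.exists_meromorphic_extension_of_quotient` (**proved**, complex analysis): if `Z`, `A`
  are meromorphic on `ℂ`, `A` is not locally zero, and `Z = A · L` on `re s > x₀`, then some
  meromorphic `g` on `ℂ` agrees with `L` on `re s > x₀` (no hypothesis on `L`: `Z / A = L` off
  the zeros of `A`, which do not accumulate, and meromorphy is insensitive to values on a
  punctured-discrete set). This is step (v) of the printed proof: `L^S(s, π) = Z(Φ, s, f) /
  ∏_{v ∈ S ∪ ∞} Z_v(Φ_v, s, f_v)` with `Z` the global zeta integral (entire for `n ≥ 2`,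
  LNM 260 Thm. 13.8 / Jacquet (1979), Thm. (6.2)) and `Z_v` the local zeta integrals at the
  finitely many bad places (meromorphic and `≢ 0` for suitable data, LNM 260 Thm. 3.3 and §8).
* `GodementJacquet1972_meromorphic_partialStandardL` (**named fact**, LNM 260 Thm. 13.8 with
  Thm. 3.3, as printed: continuation from *a* right half-plane) and
  `JacquetShalika1981_differentiableOn_partialStandardL` (**named fact**, Jacquet–Shalika (1981)
  Thm. (5.3): `L^S(s, π)` is holomorphic on the half-plane `re s > 1` of absolute convergence);
  `GodementJacquet1972_meromorphic_partialStandardL_of_zeta_quotients` (**proved**): the first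
  follows from a "zeta-quotient representation" of `L^S` by
  `exists_meromorphic_extension_of_quotient`.
* `Lang.partialStandardL_hasMeromorphicContinuation_of_halfPlane` and
  `Lang.godementJacquet_hasMeromorphicContinuation_of_halfPlane` (**proved**): the two lang.S21
  meromorphic-continuation facts from the two named inputs.
* `differentiableOn_partialStandardL_of_norm_sub_one_le` (**proved**, Weierstrass): on a
  half-plane where the local factors `P_v(s) = ∏_{a ∈ α v}(1 - a q_v^{-s})` satisfy
  `‖P_v(s) - 1‖ ≤ u_v`, `∑ u_v < ∞`, and do not vanish, `L^S(s, α)` is holomorphic and non-zero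
  (locally uniform convergence, Mathlib `Summable.hasProdLocallyUniformlyOn_one_add` and
  `TendstoLocallyUniformlyOn.differentiableOn`); hence
  `differentiableOn_partialStandardL_of_lt_re` (**proved**, unconditional: holomorphic and
  non-zero on `re s > n² + 2`, by the trivial bound `IsSatakeFamilyOf.norm_le_rpow` of
  `SatakeParameterTrivialBound`) and `differentiableOn_partialStandardL_of_summable` (**proved**):
  holomorphy on `re s > 1` from the single Jacquet–Shalika input (5.3.3)–(5.3.4)
  `summable_normSq_trace_satakePow` of `AutomorphicLFunctionProofs`; so the second named input is
  discharged from that input (`JacquetShalika1981_differentiableOn_partialStandardL_of_summable`);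
  and `exists_meromorphic_eq_partialStandardL_of_lt_re` (**proved**): in the Godement–Jacquet
  input the abscissa may be taken to be `n² + 2`, unconditionally.
* `Lang.godementJacquet_hasMeromorphicContinuation_of_GJ_of_summable` (**proved**): the fact from
  `GodementJacquet1972_meromorphic_partialStandardL` and `summable_normSq_trace_satakePow` — the
  current frontier of `godementJacquet_hasMeromorphicContinuation_holds`.

What remains for an unconditional `godementJacquet_hasMeromorphicContinuation_holds` is therefore
(a) the global and local Godement–Jacquet theory producing the zeta-quotient representation
(definitions of the global zeta integral `Z(Φ, s, φ, φ̃) = ∫_{GL_n(𝔸_K)} Φ(x) ⟨π(x)φ, φ̃⟩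
|det x|^{s + (n-1)/2} d^×x`, its Euler factorisation with the unramified computation
`Z_v(1_{M_n(𝒪_v)}, s, f_v°) = L(s, π_v)`, and the local integrals at `v ∈ S ∪ ∞`), and (b) the
Jacquet–Shalika input (5.3.3)–(5.3.4), reduced elsewhere in the tree to Lemma (5.2) of
Jacquet–Shalika (1981) (global Rankin–Selberg theory for `GL_n × GL_n`).

## References

* R. Godement, H. Jacquet, *Zeta functions of simple algebras*, Lecture Notes in Math. 260,
  Springer (1972): Thm. 3.3 (non-archimedean local factors), §8 (archimedean local theory),
  Thm. 13.8 (global) [GodementJacquet1972].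
* H. Jacquet, *Principal L-functions of the linear group*, Proc. Sympos. Pure Math. 33 (Corvallis
  1977), part 2, 63–86: Thm. (6.2) [JacquetCorvallis1979].
* H. Jacquet, J. A. Shalika, *On Euler products and the classification of automorphic
  representations I*, Amer. J. Math. 103 (1981), 499–558: Thm. (5.3) p. 555, (3) p. 556
  [JacquetShalikaAJM1981].
* Z. Rudnick, P. Sarnak, *Zeros of principal L-functions and random matrix theory*, Duke Math.
  J. 81 (1996), 269–322: §2, p. 276, (2.8)–(2.9) (restatement of the Godement–Jacquet theorem)
  [RudnickSarnak1996].
* J. R. Getz, H. Hahn, *An Introduction to Automorphic Representations*, GTM 300, Springer (2024),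
  Thm. 11.7.1 and §11.1 [GetzHahn2024].
-/

noncomputable section

open Set Filter Topology NumberField IsDedekindDomain MeasureTheory Complex

/-! ### Complex-analytic glue -/

namespace Literature.NumberTheory.Automorphic.LFunction

/-- **Upgrading a continuation from a right half-plane** (general abscissa). Let `g₀` be
meromorphic on `ℂ` and agree with `L` on some right half-plane `re s > x₀`, and let `L` be
holomorphic on `re s > c`. Then some function meromorphic on `ℂ` agrees with `L` on all of
`re s > c`. Proof: `g₀ - L` is meromorphic on the connected open half-plane `U = {re s > c}` and
vanishes on the non-empty open subset `{re s > max x₀ c}`, so by the identity principle for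
meromorphic functions (Mathlib `MeromorphicOn.meromorphicOrderAt_ne_top_of_isPreconnected`) it
vanishes on a punctured neighbourhood of every point of `U`; at the points of `U` where `g₀` is
analytic this gives `g₀ = L` (both sides are continuous), and every point of `ℂ` has a punctured
neighbourhood on which `g₀` is analytic, so the function equal to `L` on `U` and to `g₀` elsewhere
agrees with `g₀` near every point (puncturedly) and is meromorphic. [folklore] -/
theorem exists_meromorphic_eqOn_halfPlane {c x₀ : ℝ} {L g₀ : ℂ → ℂ} (hg₀ : Meromorphic g₀)
    (hx : ∀ s : ℂ, x₀ < s.re → g₀ s = L s) (hL : DifferentiableOn ℂ L {s : ℂ | c < s.re}) :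
    ∃ g : ℂ → ℂ, Meromorphic g ∧ ∀ s : ℂ, c < s.re → g s = L s := by
  classical
  set U : Set ℂ := {s : ℂ | c < s.re} with hU
  have hUo : IsOpen U := isOpen_lt continuous_const Complex.continuous_re
  have hLan : AnalyticOnNhd ℂ L U := hL.analyticOnNhd hUo
  -- the difference `g₀ - L` is meromorphic on `U`
  have hD : MeromorphicOn (fun s => g₀ s - L s) U := fun s hs =>
    (hg₀ s).sub (hLan s hs).meromorphicAt
  -- and has order `⊤` at every point of `U`
  have htop : ∀ s ∈ U, meromorphicOrderAt (fun s => g₀ s - L s) s = ⊤ := by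
    set s₁ : ℂ := ((max x₀ c + 1 : ℝ) : ℂ) with hs₁
    have hs₁re : s₁.re = max x₀ c + 1 := by rw [hs₁, Complex.ofReal_re]
    have hs₁U : s₁ ∈ U := by
      show c < s₁.re
      rw [hs₁re]
      exact (le_max_right x₀ c).trans_lt (lt_add_one _)
    have h₁ : meromorphicOrderAt (fun s => g₀ s - L s) s₁ = ⊤ := by
      rw [meromorphicOrderAt_eq_top_iff]
      apply eventually_nhdsWithin_of_eventually_nhds
      have hmem : {s : ℂ | max x₀ c < s.re} ∈ 𝓝 s₁ :=
        (isOpen_lt continuous_const Complex.continuous_re).mem_nhds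
          (show max x₀ c < s₁.re by rw [hs₁re]; exact lt_add_one _)
      filter_upwards [hmem] with z hz
      exact sub_eq_zero.2 (hx z ((le_max_left x₀ c).trans_lt hz))
    intro s hs
    by_contra hne
    exact hD.meromorphicOrderAt_ne_top_of_isPreconnected
      (convex_halfSpace_re_gt c).isPreconnected hs hs₁U hne h₁
  refine ⟨fun s => if c < s.re then L s else g₀ s, fun s => ?_, fun s hs => if_pos hs⟩
  -- meromorphy at `s`: the patched function agrees with `g₀` on a punctured neighbourhood of `s`
  refine (hg₀ s).congr ?_
  filter_upwards [(hg₀ s).eventually_analyticAt] with w hw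
  by_cases hw₁ : c < w.re
  · rw [if_pos hw₁]
    -- `g₀ w = L w`: the difference is continuous at `w` and vanishes on a punctured neighbourhood
    have h0 : ∀ᶠ z in 𝓝[≠] w, g₀ z - L z = 0 := meromorphicOrderAt_eq_top_iff.1 (htop w hw₁)
    have hc : ContinuousAt (fun z => g₀ z - L z) w :=
      hw.continuousAt.sub (hLan w hw₁).continuousAt
    have ht : Tendsto (fun z => g₀ z - L z) (𝓝[≠] w) (𝓝 (g₀ w - L w)) :=
      hc.tendsto.mono_left nhdsWithin_le_nhds
    have ht0 : Tendsto (fun z => g₀ z - L z) (𝓝[≠] w) (𝓝 0) :=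
      tendsto_const_nhds.congr' (h0.mono fun z hz => hz.symm)
    exact sub_eq_zero.1 (tendsto_nhds_unique ht ht0)
  · rw [if_neg hw₁]

/-- **Upgrading a continuation from a right half-plane to `HasMeromorphicContinuation`.** If `g₀`
is meromorphic on `ℂ` and agrees with `L` on some right half-plane `re s > x₀`, and `L` is
holomorphic on `re s > 1`, then `L` has meromorphic continuation in the sense of
`HasMeromorphicContinuation` (agreement on all of `re s > 1`): the case `c = 1` of
`exists_meromorphic_eqOn_halfPlane`. This is how the continuation "to the whole plane" of an
Euler product known to converge on `re s > 1` (Jacquet–Shalika (1981), Thm. (5.3)) but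
represented by zeta integrals only far to the right (Godement–Jacquet (1972), Thm. 13.8) is read.
[folklore] -/
theorem hasMeromorphicContinuation_of_halfPlane {x₀ : ℝ} {L g₀ : ℂ → ℂ} (hg₀ : Meromorphic g₀)
    (hx : ∀ s : ℂ, x₀ < s.re → g₀ s = L s) (hL : DifferentiableOn ℂ L {s : ℂ | 1 < s.re}) :
    GaloisRepresentations.LFunction.HasMeromorphicContinuation L :=
  exists_meromorphic_eqOn_halfPlane hg₀ hx hL

/-- **Meromorphic extension from a quotient representation.** Let `Z`, `A` be meromorphic on `ℂ`
with `A` not locally zero (finite order at some point, hence — `ℂ` being connected — at every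
point), and suppose `Z s = A s * L s` for `re s > x₀`. Then some function meromorphic on `ℂ`
agrees with `L` on `re s > x₀`. No hypothesis on `L` is needed: off the zeros of `A`, which do
not accumulate anywhere, `L = Z / A` on the half-plane, and meromorphy at a point only depends on
the germ on a punctured neighbourhood. In the proof of Godement–Jacquet (1972), Thm. 13.8
(Jacquet (1979), §6) `L = L^S(s, π)`, `Z` is the global zeta integral of factorizable data
unramified outside `S` and `A` the product of the local zeta integrals at the places of `S` and at
infinity. [folklore] -/
theorem exists_meromorphic_extension_of_quotient {x₀ : ℝ} {L Z A : ℂ → ℂ} (hZ : Meromorphic Z)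
    (hA : Meromorphic A) (hA₀ : ∃ s₀ : ℂ, meromorphicOrderAt A s₀ ≠ ⊤)
    (h : ∀ s : ℂ, x₀ < s.re → Z s = A s * L s) :
    ∃ g : ℂ → ℂ, Meromorphic g ∧ ∀ s : ℂ, x₀ < s.re → g s = L s := by
  classical
  obtain ⟨s₀, hs₀⟩ := hA₀
  have hA' : ∀ s : ℂ, meromorphicOrderAt A s ≠ ⊤ := fun s =>
    hA.meromorphicOn.meromorphicOrderAt_ne_top_of_isPreconnected isPreconnected_univ
      (mem_univ s₀) (mem_univ s) hs₀
  refine ⟨fun s => if x₀ < s.re then L s else Z s / A s, fun s => ?_, fun s hs => if_pos hs⟩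
  refine ((hZ s).div (hA s)).congr ?_
  filter_upwards [(meromorphicOrderAt_ne_top_iff_eventually_ne_zero (hA s)).1 (hA' s)] with w hw
  by_cases hw' : x₀ < w.re
  · rw [if_pos hw', Pi.div_apply, h w hw', mul_div_cancel_left₀ _ hw]
  · rw [if_neg hw', Pi.div_apply]

/-- Variant of `exists_meromorphic_extension_of_quotient` with the non-degeneracy of `A` witnessed
by a point where `A` is analytic and non-zero (e.g. a point of the half-plane of convergence where
the local zeta integrals have been chosen non-zero, Jacquet (1979), §6). [folklore] -/
theorem exists_meromorphic_extension_of_quotient' {x₀ : ℝ} {L Z A : ℂ → ℂ} (hZ : Meromorphic Z)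
    (hA : Meromorphic A) (hA₀ : ∃ s₀ : ℂ, AnalyticAt ℂ A s₀ ∧ A s₀ ≠ 0)
    (h : ∀ s : ℂ, x₀ < s.re → Z s = A s * L s) :
    ∃ g : ℂ → ℂ, Meromorphic g ∧ ∀ s : ℂ, x₀ < s.re → g s = L s := by
  obtain ⟨s₀, han, hne⟩ := hA₀
  refine exists_meromorphic_extension_of_quotient hZ hA ⟨s₀, ?_⟩ h
  rw [meromorphicOrderAt_ne_top_iff_eventually_ne_zero (hA s₀)]
  exact eventually_nhdsWithin_of_eventually_nhds
    ((han.continuousAt.ne_iff_eventually_ne continuousAt_const).mp hne)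

end Literature.NumberTheory.Automorphic.LFunction

namespace Literature.NumberTheory.Automorphic

/-! ### The datum with trivial factors at the exceptional places -/

section Data

variable {n : ℕ} {K : Type} [Field K] [NumberField K]
  {μ : Measure (AdelicGroupData.gl n K).automorphicQuotient}
  [(AdelicGroupData.gl n K).IsAutomorphicMeasure μ]

namespace StandardLFunctionData

variable (P : CuspidalAutomorphicRepGL n K μ)

open scoped Classical in
/-- The standard L-function datum of `Π` with exceptional set `S` (consisting of ramified places),
an honest Satake family `α` of `Π` off `S`, and the local factor `1` at every `v ∈ S` (the kind of
junk ramified factor the faithfulness analysis of `AutomorphicLFunction` accounts for; the *true*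
Godement–Jacquet factors `L(s, Π_v) = P_v(q_v^{-s})⁻¹`, Godement–Jacquet (1972), Thm. 3.3, are
not constructed in the tree). Generalises `StandardLFunctionData.ofUnramified` (`S = ∅`) and is
the datum built inline in `StandardLFunctionData.nonempty_of_exists_isSatakeFamilyOf`. [folklore] -/
def ofSatakeFamily (S : Finset (HeightOneSpectrum (𝓞 K))) (α : SatakeFamily K)
    (hα : IsSatakeFamilyOf P ↑S α) (hS : ∀ v ∈ S, ¬ IsUnramifiedAt P.1 v) :
    StandardLFunctionData P where
  S := S
  α := α
  isSatakeFamily := hα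
  not_isUnramifiedAt := hS
  localFactor v := if v ∈ S then 1 else eulerPolynomial (α v)
  localFactor_of_not_mem v hv := if_neg hv
  eval_zero_localFactor v := by split_ifs <;> simp
  natDegree_localFactor_le v := by
    split_ifs with hv
    · simp
    · exact (natDegree_eulerPolynomial_le (α v)).trans (hα.card_eq (by simpa using hv)).le

variable {P}

/-- The exceptional set of `ofSatakeFamily P S α hα hS` is `S` (definitional). [folklore] -/
@[simp]
theorem ofSatakeFamily_S (S : Finset (HeightOneSpectrum (𝓞 K))) (α : SatakeFamily K)
    (hα : IsSatakeFamilyOf P ↑S α) (hS : ∀ v ∈ S, ¬ IsUnramifiedAt P.1 v) :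
    (ofSatakeFamily P S α hα hS).S = S :=
  rfl

/-- The Satake family of `ofSatakeFamily P S α hα hS` is `α` (definitional). [folklore] -/
@[simp]
theorem ofSatakeFamily_α (S : Finset (HeightOneSpectrum (𝓞 K))) (α : SatakeFamily K)
    (hα : IsSatakeFamilyOf P ↑S α) (hS : ∀ v ∈ S, ¬ IsUnramifiedAt P.1 v) :
    (ofSatakeFamily P S α hα hS).α = α :=
  rfl

/-- The local factors of `ofSatakeFamily P S α hα hS`: `1` on `S`, the Satake Euler polynomial
off `S` (for any decidability instance on `v ∈ S`). [folklore] -/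
theorem ofSatakeFamily_localFactor (S : Finset (HeightOneSpectrum (𝓞 K))) (α : SatakeFamily K)
    (hα : IsSatakeFamilyOf P ↑S α) (hS : ∀ v ∈ S, ¬ IsUnramifiedAt P.1 v)
    (v : HeightOneSpectrum (𝓞 K)) [Decidable (v ∈ S)] :
    (ofSatakeFamily P S α hα hS).localFactor v = if v ∈ S then 1 else eulerPolynomial (α v) := by
  simp only [ofSatakeFamily]
  congr

/-- **The L-function of the datum with trivial exceptional factors is the partial standard
L-function** `L^S(s, α) = ∏'_{v ∉ S} (∏_{a ∈ α v} (1 - a q_v^{-s}))⁻¹`, for *every* `s`: the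
inverted local factor is `1` at `v ∈ S`, so the `tprod` over all places equals the `tprod` over
`{v // v ∉ S}` (Mathlib `tprod_subtype_eq_of_mulSupport_subset`; no multipliability is needed).
[folklore] -/
theorem ofSatakeFamily_L (S : Finset (HeightOneSpectrum (𝓞 K))) (α : SatakeFamily K)
    (hα : IsSatakeFamilyOf P ↑S α) (hS : ∀ v ∈ S, ¬ IsUnramifiedAt P.1 v) (s : ℂ) :
    (ofSatakeFamily P S α hα hS).L s = partialStandardL ↑S α s := by
  classical
  simp only [StandardLFunctionData.L, partialStandardL]
  have hsupp : (Function.mulSupport fun v : HeightOneSpectrum (𝓞 K) =>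
      (((ofSatakeFamily P S α hα hS).localFactor v).eval ((v.residueCard : ℂ) ^ (-s)))⁻¹) ⊆
      {v | v ∉ (↑S : Set (HeightOneSpectrum (𝓞 K)))} := by
    intro v hv
    simp only [Function.mem_mulSupport] at hv
    intro hvS
    apply hv
    rw [ofSatakeFamily_localFactor, if_pos (Finset.mem_coe.mp hvS)]
    simp
  rw [← tprod_subtype_eq_of_mulSupport_subset hsupp]
  refine tprod_congr fun v => ?_
  rw [ofSatakeFamily_localFactor, if_neg (fun h => v.2 (Finset.mem_coe.mpr h))]

end StandardLFunctionData

end Data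

/-! ### Named inputs: Godement–Jacquet Thm. 13.8 and Jacquet–Shalika Thm. (5.3) -/

section Inputs

variable {n : ℕ} {K : Type} [Field K] [NumberField K]
  {μ : Measure (AdelicGroupData.gl n K).automorphicQuotient}
  [(AdelicGroupData.gl n K).IsAutomorphicMeasure μ]

/-- **Godement–Jacquet, Thm. 13.8 (meromorphic continuation from a right half-plane), for the
partial standard L-functions.** Let `Π` be a cuspidal automorphic representation of `GL_n(𝔸_K)`,
`S` a finite set of finite places containing every ramified place of `Π`, and `α` an honest
Satake family of `Π` off `S`. Then there are an abscissa `x₀` and a function `g` meromorphic on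
all of `ℂ` with `g(s) = L^S(s, Π) = ∏_{v ∉ S} ∏_{a ∈ α v} (1 - a q_v^{-s})⁻¹`
(`partialStandardL ↑S α s`) for `re s > x₀`. In print (LNM 260, Thm. 13.8, for `π = ⊗ π_v` an
automorphic cuspidal representation of `GL_n` over a global field): (1) the Euler products
`L(s, π) = ∏_v L(s, π_v)`, `L(s, π̃) = ∏_v L(s, π̃_v)` converge absolutely in a right half-plane;
(2) they extend to meromorphic functions on `ℂ` (entire unless `n = 1` and `π` is a power of the
idelic norm; for the trivial character `L(s, π) = ζ_K(s)`), bounded in vertical strips away from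
the poles; (3) `L(s, π) = ε(s, π) L(1 - s, π̃)`. By Thm. 3.3 loc. cit. each finite local factor is
`P_v(q_v^{-s})⁻¹` with `P_v ∈ ℂ[X]`, `P_v(0) = 1`, so removing the finitely many factors at
`v ∈ S` (and the archimedean Gamma factors) preserves meromorphy: the statement below is part (2)
for `L^S`, with `x₀` at least the abscissa of (1), where the `tprod` is the value of the
convergent product. Only this right-half-plane form is printed in LNM 260; agreement down to
`re s > 1` is Jacquet–Shalika's theorem (`JacquetShalika1981_differentiableOn_partialStandardL`
and `LFunction.hasMeromorphicContinuation_of_halfPlane`). Whether the tree's Hecke normalisation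
(`HasSatakeParameterAt`) makes `α v` the Satake class of `Π_v` or of the contragredient `Π̃_v`
(cf. `absolutelyConvergent_partialStandardL` of `AutomorphicLFunctionProofs`), the statement is
covered, Thm. 13.8 treating `L(s, π)` and `L(s, π̃)` alike. Restated: Jacquet (1979), Thm. (6.2);
Rudnick–Sarnak (1996), §2, p. 276; Getz–Hahn (2024), Thm. 11.7.1 (`m = 1`).
[cite: GodementJacquet1972, Thm. 13.8 with Thm. 3.3] -/
def GodementJacquet1972_meromorphic_partialStandardL : Prop :=
  ∀ (P : CuspidalAutomorphicRepGL n K μ) (S : Finset (HeightOneSpectrum (𝓞 K)))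
    (α : SatakeFamily K) (_hα : IsSatakeFamilyOf P ↑S α)
    (_hS : ∀ v, IsUnramifiedAt P.1 v ∨ v ∈ S),
    ∃ (x₀ : ℝ) (g : ℂ → ℂ), Meromorphic g ∧ ∀ s : ℂ, x₀ < s.re → g s = partialStandardL ↑S α s

/-- **Jacquet–Shalika: the partial standard Euler product is holomorphic on `re s > 1`.** For a
(unitary) cuspidal automorphic representation `Π` of `GL_n(𝔸_K)` and an honest Satake family `α`
of `Π` off `S`, the partial standard L-function `L^S(s, Π) = ∏_{v ∉ S} ∏_{a ∈ α v}
(1 - a q_v^{-s})⁻¹` (`partialStandardL S α`, a `tprod`, the value of the convergent product on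
`re s > 1` by `multipliable_partialStandardL`) is holomorphic on the open half-plane `re s > 1`:
Jacquet–Shalika (1981), Thm. (5.3) with Remark (5.4) (`p = 1`, `π' = 1`) — the Euler product
`L_S(s, π)` is absolutely convergent in the half-plane `re s > 1` — together with the classical
fact that an Euler product is holomorphic on every half-plane on which it converges normally
(here: every `re s > σ₁`, `σ₁ > 1`). Cuspidal representations in
`L²(GL_n(K) A_G \ GL_n(𝔸_K))` are unitary (outline D10). Derived below from the single input
(5.3.3)–(5.3.4) `summable_normSq_trace_satakePow` of `AutomorphicLFunctionProofs`
(`JacquetShalika1981_differentiableOn_partialStandardL_of_summable`, by normal convergence of the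
Euler product on every half-plane `re s > σ₁ > 1`).
[cite: JacquetShalikaAJM1981, Thm. (5.3), Remark (5.4)] -/
def JacquetShalika1981_differentiableOn_partialStandardL : Prop :=
  ∀ (P : CuspidalAutomorphicRepGL n K μ) (S : Finset (HeightOneSpectrum (𝓞 K)))
    (α : SatakeFamily K) (_hα : IsSatakeFamilyOf P ↑S α),
    DifferentiableOn ℂ (partialStandardL ↑S α) {s : ℂ | 1 < s.re}

/-- **Godement–Jacquet's continuation from the zeta-quotient representation.** Suppose that for
every cuspidal `Π`, every finite `S` containing the ramified places and every honest Satake family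
`α` of `Π` off `S` there are an abscissa `x₀` and functions `Z`, `A` meromorphic on `ℂ`, `A` not
locally zero, with `Z(s) = A(s) · L^S(s, Π)` for `re s > x₀` — in the source `Z = Z(Φ, s, φ, φ̃)`
is the global zeta integral of factorizable data unramified outside `S` (entire for `n ≥ 2`,
meromorphic for `n = 1`: LNM 260, Thm. 13.8; Jacquet (1979), Thm. (6.2), via Poisson summation
on `M_n(K) ⊂ M_n(𝔸_K)`), `A = ∏_{v ∈ S} Z_v(Φ_v, s, f_v) · ∏_{v ∣ ∞} Z_v(Φ_v, s, f_v)` is the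
finite product of local zeta integrals (rational in `q_v^{-s}`, resp. of Gamma type, and non-zero
for suitable data: LNM 260, Thm. 3.3 and §8), and the identity is the Euler factorisation with
the unramified computation `Z_v(1_{M_n(𝒪_v)}, s, f_v°) = L(s, π_v)` on the half-plane of absolute
convergence. Then `GodementJacquet1972_meromorphic_partialStandardL` holds
(`LFunction.exists_meromorphic_extension_of_quotient`).
[cite: GodementJacquet1972, Thm. 13.8 with Thm. 3.3 and §8] -/
theorem GodementJacquet1972_meromorphic_partialStandardL_of_zeta_quotients
    (h : ∀ (P : CuspidalAutomorphicRepGL n K μ) (S : Finset (HeightOneSpectrum (𝓞 K)))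
      (α : SatakeFamily K), IsSatakeFamilyOf P ↑S α → (∀ v, IsUnramifiedAt P.1 v ∨ v ∈ S) →
        ∃ (x₀ : ℝ) (Z A : ℂ → ℂ), Meromorphic Z ∧ Meromorphic A ∧
          (∃ s₀ : ℂ, meromorphicOrderAt A s₀ ≠ ⊤) ∧
            ∀ s : ℂ, x₀ < s.re → Z s = A s * partialStandardL ↑S α s) :
    GodementJacquet1972_meromorphic_partialStandardL (μ := μ) := by
  intro P S α hα hS
  obtain ⟨x₀, Z, A, hZ, hA, hA₀, hZA⟩ := h P S α hα hS
  exact ⟨x₀, LFunction.exists_meromorphic_extension_of_quotient hZ hA hA₀ hZA⟩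

end Inputs

/-! ### Holomorphy of the partial standard Euler product on half-planes of normal convergence -/

section Holomorphy

variable {K : Type} [Field K] [NumberField K]

/-- The local Euler factor `s ↦ ∏_{a ∈ α} (1 - a q^{-s})` is an entire function of `s`
(`q ≠ 0`; a polynomial in `q^{-s} = exp(-s log q)`). [folklore] -/
theorem differentiable_eval_eulerPolynomial_cpow_neg (α : Multiset ℂ) {q : ℕ} (hq : q ≠ 0) :
    Differentiable ℂ fun s : ℂ => (eulerPolynomial α).eval ((q : ℂ) ^ (-s)) :=
  (eulerPolynomial α).differentiable.comp
    (differentiable_id.neg.const_cpow (Or.inl (Nat.cast_ne_zero.mpr hq)))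

/-- If `‖a x‖ < 1` for all `a ∈ α` then `∏_{a ∈ α} (1 - a x) ≠ 0` (Jacquet–Shalika (1981),
p. 555: "the individual terms in this finite product are of the form `(1 - z)⁻¹` with
`|z| < 1`"). [folklore] -/
theorem eval_eulerPolynomial_ne_zero_of_norm_mul_lt_one {α : Multiset ℂ} {x : ℂ}
    (h : ∀ a ∈ α, ‖a * x‖ < 1) : (eulerPolynomial α).eval x ≠ 0 := by
  rw [eval_eulerPolynomial]
  refine Multiset.prod_ne_zero fun h0 => ?_
  obtain ⟨a, ha, h1⟩ := Multiset.mem_map.mp h0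
  have hax : a * x = 1 := (sub_eq_zero.mp h1).symm
  have hlt := h a ha
  rw [hax, norm_one] at hlt
  exact lt_irrefl _ hlt

/-- Holomorphy on an open right half-plane from holomorphy on every strictly smaller one.
[folklore] -/
theorem differentiableOn_halfPlane_of_forall_lt {f : ℂ → ℂ} {σ₀ : ℝ}
    (h : ∀ σ₁ : ℝ, σ₀ < σ₁ → DifferentiableOn ℂ f {s : ℂ | σ₁ < s.re}) :
    DifferentiableOn ℂ f {s : ℂ | σ₀ < s.re} := by
  intro s hs
  have hs' : σ₀ < s.re := hs
  have h₁ : σ₀ < (σ₀ + s.re) / 2 := by linarith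
  have h₂ : (σ₀ + s.re) / 2 < s.re := by linarith
  exact ((h _ h₁).differentiableAt
    ((isOpen_lt continuous_const Complex.continuous_re).mem_nhds h₂)).differentiableWithinAt

/-- **Weierstrass: holomorphy and non-vanishing of the partial standard Euler product on a
half-plane of normal convergence.** Let `α` be a Satake family and suppose that on the half-plane
`re s > σ₀` the local factors `P_v(s) = ∏_{a ∈ α v} (1 - a q_v^{-s})`, `v ∉ S`, satisfy
`‖P_v(s) - 1‖ ≤ u_v` with `∑_v u_v < ∞` and do not vanish. Then `L^S(s, α) = ∏'_{v ∉ S} P_v(s)⁻¹`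
(`partialStandardL S α`) is holomorphic and non-zero on `re s > σ₀`: the product `∏_v P_v(s)`
converges locally uniformly there (Mathlib `Summable.hasProdLocallyUniformlyOn_one_add`, the
`M`-test), so its value `E(s)` is holomorphic (`TendstoLocallyUniformlyOn.differentiableOn`) and
non-zero (`tprod_one_add_ne_zero_of_summable`), and `L^S = E⁻¹` (the partial products of the
inverses are the inverses of the partial products). This is the classical remark that an Euler
product is holomorphic on any half-plane where it converges normally (e.g. Jacquet–Shalika (1981),
(5.1.4): "the infinite product converges absolutely to an analytic function in some right
half-plane"). [folklore] -/
theorem differentiableOn_partialStandardL_of_norm_sub_one_le {S : Set (HeightOneSpectrum (𝓞 K))}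
    {α : SatakeFamily K} {σ₀ : ℝ} {u : {v : HeightOneSpectrum (𝓞 K) // v ∉ S} → ℝ}
    (hu : Summable u)
    (hle : ∀ (v : {v : HeightOneSpectrum (𝓞 K) // v ∉ S}) (s : ℂ), σ₀ < s.re →
      ‖(eulerPolynomial (α v.1)).eval ((v.1.residueCard : ℂ) ^ (-s)) - 1‖ ≤ u v)
    (hne : ∀ (v : {v : HeightOneSpectrum (𝓞 K) // v ∉ S}) (s : ℂ), σ₀ < s.re →
      (eulerPolynomial (α v.1)).eval ((v.1.residueCard : ℂ) ^ (-s)) ≠ 0) :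
    DifferentiableOn ℂ (partialStandardL S α) {s : ℂ | σ₀ < s.re} ∧
      ∀ s : ℂ, σ₀ < s.re → partialStandardL S α s ≠ 0 := by
  set U : Set ℂ := {s : ℂ | σ₀ < s.re} with hU
  have hUo : IsOpen U := isOpen_lt continuous_const Complex.continuous_re
  -- the local factors as entire functions of `s`
  set e : {v : HeightOneSpectrum (𝓞 K) // v ∉ S} → ℂ → ℂ := fun v s =>
    (eulerPolynomial (α v.1)).eval ((v.1.residueCard : ℂ) ^ (-s)) with he
  have hed : ∀ v, Differentiable ℂ (e v) := fun v =>
    differentiable_eval_eulerPolynomial_cpow_neg (α v.1)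
      (zero_lt_one.trans v.1.one_lt_residueCard).ne'
  -- normal convergence of `∏_v (1 + (e_v - 1))` on `U`
  have hprod : HasProdLocallyUniformlyOn (fun v s => 1 + (e v s - 1))
      (fun s => ∏' v, (1 + (e v s - 1))) U :=
    hu.hasProdLocallyUniformlyOn_one_add hUo
      (Eventually.of_forall fun v s hs => hle v s hs)
      (fun v => ((hed v).sub_const 1).continuous.continuousOn)
  set E : ℂ → ℂ := fun s => ∏' v, (1 + (e v s - 1)) with hE
  -- `E` is holomorphic on `U`, as a locally uniform limit of finite products of entire functions
  have hEd : DifferentiableOn ℂ E U := by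
    refine (hasProdLocallyUniformlyOn_iff_tendstoLocallyUniformlyOn.mp hprod).differentiableOn
      (Eventually.of_forall fun F => ?_) hUo
    exact (Differentiable.fun_finsetProd fun v _ =>
      ((hed v).sub_const 1).const_add 1).differentiableOn
  -- at each point of `U`: `E s ≠ 0` and `L^S(s) = (E s)⁻¹`
  have hpt : ∀ s ∈ U, E s ≠ 0 ∧ partialStandardL S α s = (E s)⁻¹ := by
    intro s hs
    have hsum : Summable fun v => ‖e v s - 1‖ :=
      hu.of_nonneg_of_le (fun v => norm_nonneg _) (fun v => hle v s hs)
    have hE0 : E s ≠ 0 :=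
      tprod_one_add_ne_zero_of_summable (fun v => by rw [add_sub_cancel]; exact hne v s hs) hsum
    refine ⟨hE0, ?_⟩
    have hP : HasProd (fun v => 1 + (e v s - 1)) (E s) := hprod.hasProd hs
    have hP₁ : HasProd (fun v => e v s) (E s) := by simpa only [add_sub_cancel] using hP
    have hP₂ : HasProd (fun v => (e v s)⁻¹) (E s)⁻¹ := by
      unfold HasProd at hP₁ ⊢
      simpa only [Finset.prod_inv_distrib] using hP₁.inv₀ hE0
    exact hP₂.tprod_eq
  refine ⟨?_, fun s hs => ?_⟩
  · exact (hEd.inv fun s hs => (hpt s hs).1).congr fun s hs => (hpt s hs).2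
  · rw [(hpt s hs).2]
    exact inv_ne_zero (hpt s hs).1

end Holomorphy

section HolomorphyCuspidal

variable {n : ℕ} {K : Type} [Field K] [NumberField K]
  {μ : Measure (AdelicGroupData.gl n K).automorphicQuotient}
  [(AdelicGroupData.gl n K).IsAutomorphicMeasure μ]

/-- **The partial standard Euler product of a cuspidal `Π` is holomorphic and non-zero on
`re s > n² + 2`, unconditionally.** With the trivial bound `‖a‖ ≤ q_v^{n² + 1}` on the
Hecke–Satake parameters (`IsSatakeFamilyOf.norm_le_rpow` of `SatakeParameterTrivialBound`, proved
from the definitions), `‖∏_{a ∈ α v}(1 - a q_v^{-s}) - 1‖ ≤ (2^n - 1) q_v^{n² + 1 - σ₁}`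
uniformly on `re s > σ₁`, summable over `v` for `σ₁ > n² + 2`; now apply
`differentiableOn_partialStandardL_of_norm_sub_one_le` on every such half-plane (the analogue for
`L^S(s, π)` of Jacquet–Shalika (1981), (5.1.4), with an explicit half-plane). [folklore] -/
theorem differentiableOn_partialStandardL_of_lt_re (P : CuspidalAutomorphicRepGL n K μ)
    {S : Set (HeightOneSpectrum (𝓞 K))} {α : SatakeFamily K} (hα : IsSatakeFamilyOf P S α) :
    DifferentiableOn ℂ (partialStandardL S α) {s : ℂ | (n : ℝ) ^ 2 + 2 < s.re} ∧
      ∀ s : ℂ, (n : ℝ) ^ 2 + 2 < s.re → partialStandardL S α s ≠ 0 := by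
  set B : ℝ := (n : ℝ) ^ 2 + 1 with hB
  have hB0 : 0 ≤ B := by positivity
  -- the estimate on `re s > σ₁`, for any `σ₁ > n² + 2 = B + 1`
  have key : ∀ σ₁ : ℝ, (n : ℝ) ^ 2 + 2 < σ₁ →
      DifferentiableOn ℂ (partialStandardL S α) {s : ℂ | σ₁ < s.re} ∧
        ∀ s : ℂ, σ₁ < s.re → partialStandardL S α s ≠ 0 := by
    intro σ₁ hσ₁
    have ht1 : 1 < σ₁ - B := by rw [hB]; linarith
    refine differentiableOn_partialStandardL_of_norm_sub_one_le
      (u := fun v => (2 ^ n - 1) * (v.1.residueCard : ℝ) ^ (-(σ₁ - B)))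
      (((summable_residueCard_rpow_neg ht1).subtype _).mul_left (2 ^ n - 1))
      (fun v s hs => ?_) (fun v s hs => ?_)
    · -- `‖P_v(s) - 1‖ ≤ (2^n - 1) q_v^{B - re s} ≤ (2^n - 1) q_v^{B - σ₁}`
      have hs' : σ₁ < s.re := hs
      have hq1 : (1 : ℝ) < v.1.residueCard := by exact_mod_cast v.1.one_lt_residueCard
      have hq0 : (0 : ℝ) < v.1.residueCard := zero_lt_one.trans hq1
      have hx : ‖(v.1.residueCard : ℂ) ^ (-s)‖ ≤ (v.1.residueCard : ℝ) ^ (-s.re) := by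
        rw [norm_natCast_cpow_of_pos (zero_lt_one.trans v.1.one_lt_residueCard), neg_re]
      have hprod : (v.1.residueCard : ℝ) ^ B * (v.1.residueCard : ℝ) ^ (-s.re) =
          (v.1.residueCard : ℝ) ^ (-(s.re - B)) := by
        rw [← Real.rpow_add hq0]
        congr 1
        ring
      have hBt : (v.1.residueCard : ℝ) ^ B * (v.1.residueCard : ℝ) ^ (-s.re) ≤ 1 := by
        rw [hprod]
        exact Real.rpow_le_one_of_one_le_of_nonpos hq1.le (by linarith)
      obtain ⟨h1, -⟩ := norm_eval_eulerPolynomial_sub_one_le (Real.rpow_nonneg hq0.le B) hx hBt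
        (α v.1) (fun a ha => hα.norm_le_rpow v.2 ha)
      refine h1.trans ?_
      rw [hprod, hα.card_eq v.2]
      have h2n : (0 : ℝ) ≤ 2 ^ n - 1 := sub_nonneg.mpr (one_le_pow₀ (by norm_num))
      refine mul_le_mul_of_nonneg_left ?_ h2n
      exact Real.rpow_le_rpow_of_exponent_le hq1.le (by linarith)
    · -- no factor vanishes: `‖a q_v^{-s}‖ ≤ q_v^{B - re s} < 1`
      have hs' : σ₁ < s.re := hs
      have hq1 : (1 : ℝ) < v.1.residueCard := by exact_mod_cast v.1.one_lt_residueCard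
      have hq0 : (0 : ℝ) < v.1.residueCard := zero_lt_one.trans hq1
      refine eval_eulerPolynomial_ne_zero_of_norm_mul_lt_one fun a ha => ?_
      rw [norm_mul, norm_natCast_cpow_of_pos (zero_lt_one.trans v.1.one_lt_residueCard), neg_re]
      calc ‖a‖ * (v.1.residueCard : ℝ) ^ (-s.re)
          ≤ (v.1.residueCard : ℝ) ^ B * (v.1.residueCard : ℝ) ^ (-s.re) := by
            gcongr
            exact hα.norm_le_rpow v.2 ha
        _ = (v.1.residueCard : ℝ) ^ (B - s.re) := by
            rw [← Real.rpow_add hq0]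
            ring_nf
        _ < 1 := Real.rpow_lt_one_of_one_lt_of_neg hq1 (by linarith)
  refine ⟨differentiableOn_halfPlane_of_forall_lt fun σ₁ hσ₁ => (key σ₁ hσ₁).1, fun s hs => ?_⟩
  have h₁ : (n : ℝ) ^ 2 + 2 < ((n : ℝ) ^ 2 + 2 + s.re) / 2 := by linarith
  have h₂ : ((n : ℝ) ^ 2 + 2 + s.re) / 2 < s.re := by linarith
  exact (key _ h₁).2 s h₂

/-- **Normal form of the Godement–Jacquet input.** Under
`GodementJacquet1972_meromorphic_partialStandardL` the abscissa may be taken to be `n² + 2`,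
unconditionally: the meromorphic function agreeing with `L^S(s, Π)` far to the right agrees with
it on the whole half-plane `re s > n² + 2`, where the Euler product is holomorphic by the trivial
bound (`differentiableOn_partialStandardL_of_lt_re`, `exists_meromorphic_eqOn_halfPlane`).
[cite: GodementJacquet1972, Thm. 13.8 with Thm. 3.3] -/
theorem exists_meromorphic_eq_partialStandardL_of_lt_re
    (h₁ : GodementJacquet1972_meromorphic_partialStandardL (μ := μ))
    (P : CuspidalAutomorphicRepGL n K μ) (S : Finset (HeightOneSpectrum (𝓞 K)))
    (α : SatakeFamily K) (hα : IsSatakeFamilyOf P ↑S α) (hS : ∀ v, IsUnramifiedAt P.1 v ∨ v ∈ S) :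
    ∃ g : ℂ → ℂ, Meromorphic g ∧
      ∀ s : ℂ, (n : ℝ) ^ 2 + 2 < s.re → g s = partialStandardL ↑S α s := by
  obtain ⟨x₀, g, hg, hgL⟩ := h₁ P S α hα hS
  exact LFunction.exists_meromorphic_eqOn_halfPlane hg hgL
    (differentiableOn_partialStandardL_of_lt_re P hα).1

/-- **Jacquet–Shalika: `L^S(s, Π)` is holomorphic and non-zero on `re s > 1`, from the single
input (5.3.3)–(5.3.4)** (`summable_normSq_trace_satakePow` of `AutomorphicLFunctionProofs`: the
convergence of `∑_{v ∉ S} ∑_k |tr A_v^k|² / (k q_v^{kσ})` for `σ > 1`, in print a consequence of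
Lemma (5.2) and Landau's lemma). The local estimate
`‖∏_{a ∈ α v}(1 - a q_v^{-s}) - 1‖ ≤ |tr A_v|² q_v^{-σ} + q_v^{-σ} + 4^n q_v^{1-2σ}`
(`norm_eval_eulerPolynomial_sub_one_le_of_sqrt`, with (5.1.3) `|a| ≤ q_v^{1/2}` itself derived
from the input, `norm_satakeParameter_le_sqrt_of_summable`) is decreasing in `σ = re s`, so on
`re s > σ₁ > 1` the deviations are bounded by the values at `σ₁`, which are summable over `v` by
the input (terms `k = 1`) and `∑_v q_v^{-t} < ∞`, `t > 1`; conclude by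
`differentiableOn_partialStandardL_of_norm_sub_one_le` on every half-plane `re s > σ₁`, `σ₁ > 1`
(Jacquet–Shalika (1981), Thm. (5.3): "the infinite product … is absolutely convergent in the
half-plane `Re(s) > 1`. In particular the function `L_S(s, π × π')` does not vanish for
`Re(s) > 1`", case `π' = 1` of Remark (5.4)).
[cite: JacquetShalikaAJM1981, Thm. (5.3), Remark (5.4)] -/
theorem differentiableOn_partialStandardL_of_summable
    (h₂ : summable_normSq_trace_satakePow (μ := μ))
    (P : CuspidalAutomorphicRepGL n K μ) {S : Set (HeightOneSpectrum (𝓞 K))} {α : SatakeFamily K}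
    (hα : IsSatakeFamilyOf P S α) :
    DifferentiableOn ℂ (partialStandardL S α) {s : ℂ | 1 < s.re} := by
  refine differentiableOn_halfPlane_of_forall_lt fun σ₁ hσ₁ => ?_
  -- the Jacquet–Shalika majorant at the real point `σ₁`
  let b : {v : HeightOneSpectrum (𝓞 K) // v ∉ S} → ℝ := fun v =>
    ‖(α v.1).sum‖ ^ 2 * (v.1.residueCard : ℝ) ^ (-σ₁) + (v.1.residueCard : ℝ) ^ (-σ₁) +
      4 ^ n * (v.1.residueCard : ℝ) ^ (1 - 2 * σ₁)
  have hb : Summable b := by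
    refine ((?_ : Summable _).add ?_).add ?_
    · refine ((h₂ P hα hσ₁).prod_factor 0).congr fun v => ?_
      have hq0 : (0 : ℝ) ≤ v.1.residueCard := Nat.cast_nonneg _
      simp [Real.rpow_neg hq0, div_eq_mul_inv]
    · exact (summable_residueCard_rpow_neg hσ₁).subtype _
    · refine (((summable_residueCard_rpow_neg (K := K) (σ := 2 * σ₁ - 1) (by linarith)).subtype
        _).mul_left (4 ^ n)).congr fun v => ?_
      simp [neg_sub]
  refine (differentiableOn_partialStandardL_of_norm_sub_one_le hb (fun v s hs => ?_)
    (fun v s hs => ?_)).1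
  · have hs' : σ₁ < s.re := hs
    have hq1 : (1 : ℝ) ≤ v.1.residueCard := by exact_mod_cast v.1.one_lt_residueCard.le
    have hcard : Multiset.card (α v.1) = n := hα.card_eq v.2
    have hest := norm_eval_eulerPolynomial_sub_one_le_of_sqrt v.1.one_lt_residueCard
      (fun a ha => norm_satakeParameter_le_sqrt_of_summable h₂ P hα v.2 ha) (s := s) (by linarith)
    rw [hcard] at hest
    refine hest.trans ?_
    have hm₁ : (v.1.residueCard : ℝ) ^ (-s.re) ≤ (v.1.residueCard : ℝ) ^ (-σ₁) :=
      Real.rpow_le_rpow_of_exponent_le hq1 (by linarith)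
    have hm₂ : (v.1.residueCard : ℝ) ^ (1 - 2 * s.re) ≤ (v.1.residueCard : ℝ) ^ (1 - 2 * σ₁) :=
      Real.rpow_le_rpow_of_exponent_le hq1 (by linarith)
    show _ ≤ ‖(α v.1).sum‖ ^ 2 * (v.1.residueCard : ℝ) ^ (-σ₁) + (v.1.residueCard : ℝ) ^ (-σ₁) +
      4 ^ n * (v.1.residueCard : ℝ) ^ (1 - 2 * σ₁)
    gcongr
  · have hs' : σ₁ < s.re := hs
    exact eval_eulerPolynomial_ne_zero_of_sqrt v.1.one_lt_residueCard
      (fun a ha => norm_satakeParameter_le_sqrt_of_summable h₂ P hα v.2 ha) (by linarith)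

/-- Hence the named input `JacquetShalika1981_differentiableOn_partialStandardL` from the single
Jacquet–Shalika input (5.3.3)–(5.3.4) (`summable_normSq_trace_satakePow`).
[cite: JacquetShalikaAJM1981, Thm. (5.3), Remark (5.4)] -/
theorem JacquetShalika1981_differentiableOn_partialStandardL_of_summable
    (h₂ : summable_normSq_trace_satakePow (μ := μ)) :
    JacquetShalika1981_differentiableOn_partialStandardL (μ := μ) :=
  fun P _S _α hα => differentiableOn_partialStandardL_of_summable h₂ P hα

end HolomorphyCuspidal

end Literature.NumberTheory.Automorphic

/-! ### The lang.S21 meromorphic-continuation facts, assembled -/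

namespace Literature.NumberTheory.Automorphic


variable {n : ℕ} {K : Type} [Field K] [NumberField K]
  {μ : Measure (AdelicGroupData.gl n K).automorphicQuotient}
  [(AdelicGroupData.gl n K).IsAutomorphicMeasure μ]

/-- **Pointwise assembly.** If the partial standard L-function of `Π` off the finite set `S` of
its ramified places (honest Satake family `α`) has meromorphic continuation, then the datum with
trivial exceptional factors has meromorphic `L` — its L-function *is* `L^S(s, α)`
(`StandardLFunctionData.ofSatakeFamily_L`). [folklore] -/
theorem exists_hasMeromorphicContinuation_of_partialStandardL (P : CuspidalAutomorphicRepGL n K μ)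
    (S : Finset (HeightOneSpectrum (𝓞 K))) (α : SatakeFamily K) (hα : IsSatakeFamilyOf P ↑S α)
    (hS : ∀ v ∈ S, ¬ IsUnramifiedAt P.1 v)
    (h : GaloisRepresentations.LFunction.HasMeromorphicContinuation (partialStandardL ↑S α)) :
    ∃ D : StandardLFunctionData P, GaloisRepresentations.LFunction.HasMeromorphicContinuation D.L := by
  obtain ⟨g, hg, hgL⟩ := h
  refine ⟨StandardLFunctionData.ofSatakeFamily P S α hα hS, g, hg, fun s hs => ?_⟩
  rw [hgL s hs, StandardLFunctionData.ofSatakeFamily_L]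

/-- **lang.S21, meromorphic continuation of `L(s, Π)` from that of the partial L-functions.**
The named fact `godementJacquet_hasMeromorphicContinuation` follows from its sibling
`partialStandardL_hasMeromorphicContinuation` (Godement–Jacquet (1972), Thm. 13.8 with Thm. 3.3;
Jacquet–Shalika (1981), Thm. 5.3) and the finiteness of the set of ramified places of a cuspidal
`Π` (Flath (1979), Thm. 3; Borel–Jacquet (1979), §4.6 — proved in the tree,
`CuspidalAutomorphicRepGL.exists_finset_isSatakeFamilyOf`): take for `D` the datum with the
honest Satake family off the ramified set `S` and the factor `1` at `v ∈ S`, whose L-function is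
`L^S(s, Π)`. [cite: GodementJacquet1972, Thm. 13.8] -/
theorem godementJacquet_hasMeromorphicContinuation_of_partialStandardL
    (h : partialStandardL_hasMeromorphicContinuation (μ := μ)) :
    godementJacquet_hasMeromorphicContinuation (μ := μ) := by
  intro P
  obtain ⟨S, α, hS, hα⟩ := P.exists_finset_isSatakeFamilyOf
  refine exists_hasMeromorphicContinuation_of_partialStandardL P S α hα hS (h P S α hα ?_)
  intro v
  by_cases hv : v ∈ S
  · exact Or.inr hv
  · exact Or.inl (hα.isUnramifiedAt (by simpa using hv))

/-- **lang.S21 for `Π` other than the trivial representation of `GL_1`, from the entire form.**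
For a cuspidal `Π` with `2 ≤ n ∨ ¬ Π.1.IsTrivialSubrep`, the named fact `godementJacquet`
(Godement–Jacquet (1972), Thm. 13.8; Jacquet (1979), Thm. (6.2): `L(s, Π)` extends to an entire
function) yields a datum with meromorphic — indeed entire — `L`
(`LFunction.HasEntireContinuation.hasMeromorphicContinuation`). The remaining case, the trivial
representation of `GL_1` with `L(s, Π) = ζ_K(s)`, is where the pole is; it is covered by
`godementJacquet_hasMeromorphicContinuation_of_partialStandardL`.
[cite: GodementJacquet1972, Thm. 13.8] -/
theorem exists_hasMeromorphicContinuation_of_godementJacquet (h : godementJacquet (μ := μ))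
    (P : CuspidalAutomorphicRepGL n K μ) (hP : 2 ≤ n ∨ ¬ P.1.IsTrivialSubrep) :
    ∃ D : StandardLFunctionData P, GaloisRepresentations.LFunction.HasMeromorphicContinuation D.L := by
  obtain ⟨D, hD, -⟩ := h P hP
  exact ⟨D, hD.hasMeromorphicContinuation⟩

/-- **lang.S21 (partial L-functions) from the two named inputs.** The named fact
`partialStandardL_hasMeromorphicContinuation` follows from Godement–Jacquet's continuation from a
right half-plane (`GodementJacquet1972_meromorphic_partialStandardL`, LNM 260 Thm. 13.8 with
Thm. 3.3) and the holomorphy of `L^S(s, Π)` on `re s > 1`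
(`JacquetShalika1981_differentiableOn_partialStandardL`, Jacquet–Shalika (1981), Thm. (5.3)), by
the identity principle (`LFunction.hasMeromorphicContinuation_of_halfPlane`).
[cite: GodementJacquet1972, Thm. 13.8] [cite: JacquetShalikaAJM1981, Thm. (5.3)] -/
theorem partialStandardL_hasMeromorphicContinuation_of_halfPlane
    (h₁ : GodementJacquet1972_meromorphic_partialStandardL (μ := μ))
    (h₂ : JacquetShalika1981_differentiableOn_partialStandardL (μ := μ)) :
    partialStandardL_hasMeromorphicContinuation (μ := μ) := by
  intro P S α hα hS
  obtain ⟨x₀, g, hg, hgL⟩ := h₁ P S α hα hS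
  exact LFunction.hasMeromorphicContinuation_of_halfPlane hg hgL (h₂ P S α hα)

/-- **lang.S21 (meromorphic continuation of `L(s, Π)`, all cuspidal `Π`) from the two named
inputs**: Godement–Jacquet (1972), Thm. 13.8 with Thm. 3.3
(`GodementJacquet1972_meromorphic_partialStandardL`) and Jacquet–Shalika (1981), Thm. (5.3)
(`JacquetShalika1981_differentiableOn_partialStandardL`), through
`partialStandardL_hasMeromorphicContinuation_of_halfPlane` and
`godementJacquet_hasMeromorphicContinuation_of_partialStandardL` (Flath's finiteness of
ramification being proved in the tree). This is the current frontier of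
`godementJacquet_hasMeromorphicContinuation_holds`. [cite: GodementJacquet1972, Thm. 13.8]
[cite: JacquetShalikaAJM1981, Thm. (5.3)] -/
theorem godementJacquet_hasMeromorphicContinuation_of_halfPlane
    (h₁ : GodementJacquet1972_meromorphic_partialStandardL (μ := μ))
    (h₂ : JacquetShalika1981_differentiableOn_partialStandardL (μ := μ)) :
    godementJacquet_hasMeromorphicContinuation (μ := μ) :=
  godementJacquet_hasMeromorphicContinuation_of_partialStandardL
    (partialStandardL_hasMeromorphicContinuation_of_halfPlane h₁ h₂)

/-- **lang.S21 (partial L-functions) from Godement–Jacquet's Thm. 13.8 and the single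
Jacquet–Shalika input (5.3.3)–(5.3.4)**: `partialStandardL_hasMeromorphicContinuation` from
`GodementJacquet1972_meromorphic_partialStandardL` and `summable_normSq_trace_satakePow`
(holomorphy of `L^S(s, Π)` on `re s > 1`, `differentiableOn_partialStandardL_of_summable`).
[cite: GodementJacquet1972, Thm. 13.8] [cite: JacquetShalikaAJM1981, Thm. (5.3)] -/
theorem partialStandardL_hasMeromorphicContinuation_of_GJ_of_summable
    (h₁ : GodementJacquet1972_meromorphic_partialStandardL (μ := μ))
    (h₂ : summable_normSq_trace_satakePow (μ := μ)) :
    partialStandardL_hasMeromorphicContinuation (μ := μ) :=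
  partialStandardL_hasMeromorphicContinuation_of_halfPlane h₁
    (JacquetShalika1981_differentiableOn_partialStandardL_of_summable h₂)

/-- **lang.S21 (meromorphic continuation of `L(s, Π)`, all cuspidal `Π`) from Godement–Jacquet's
Thm. 13.8 and the single Jacquet–Shalika input (5.3.3)–(5.3.4).** The named fact
`godementJacquet_hasMeromorphicContinuation` follows from
`GodementJacquet1972_meromorphic_partialStandardL` (LNM 260, Thm. 13.8 with Thm. 3.3: continuation
of `L^S(s, Π)` from a right half-plane) and `summable_normSq_trace_satakePow` of
`AutomorphicLFunctionProofs` (Jacquet–Shalika (1981), (5.3.3)–(5.3.4), itself reduced in the tree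
to Lemma (5.2) for the exceptional sets of that lemma), the latter supplying the holomorphy of
`L^S(s, Π)` on `re s > 1` (`differentiableOn_partialStandardL_of_summable`).
[cite: GodementJacquet1972, Thm. 13.8] [cite: JacquetShalikaAJM1981, Thm. (5.3)] -/
theorem godementJacquet_hasMeromorphicContinuation_of_GJ_of_summable
    (h₁ : GodementJacquet1972_meromorphic_partialStandardL (μ := μ))
    (h₂ : summable_normSq_trace_satakePow (μ := μ)) :
    godementJacquet_hasMeromorphicContinuation (μ := μ) :=
  godementJacquet_hasMeromorphicContinuation_of_halfPlane h₁
    (JacquetShalika1981_differentiableOn_partialStandardL_of_summable h₂)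

end Literature.NumberTheory.Automorphic
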